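import Summits.BirchSwinnertonDyer.Rank1Residual.Additive.PadicClosureCyclotomicTower
import HarnessLib

/-!
# The PLUS tower at `2`: the elements `u_m = ζ_{2^m} + ζ_{2^m}⁻¹` and the uniformizers `v_m = u_m − 2` of
# `ℚ₂(ζ_{2^m})⁺` inside `ℚ̄₂` — squares, the quadratic relation `v_m² + 4v_m = v_{m−1}`, absolute values, and the
# Galois formulas for `σ₃ : ζ ↦ ζ³` and `τ : ζ ↦ −ζ⁻¹` (K4 `SignedControlAtTwo`, stmt-BirchSwinnertonDyer-20309, line
# `eulerchar` v5/v6, stub HONDA⁺@2: first brick of the `ℤ₂`-tower `ℚ_{2,n} = ℚ₂(ζ_{2^{n+2}})⁺` on which Kobayashi's `E⁺` lives)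

Route `ThetaPartnerAtTwo` (TP2; crux shared with `ResidualThetaTransportAtTwo`), crux K4, lead seat `prover-bsd-wall-tp2-p3`
(g2). Memo of record: `Cruxes/SignedControlAtTwo/LAGPLUS-AT-2-CONSTRUCTION.md` §1 (kit-certified, j293539: tower lemma `n ≤ 9`).
Built on the O10 local series' compatible roots `PadicCyclotomicTower.zeta 2 m` (`ζ_{2^m} ∈ ℚ̄₂`, `(ζ_{m+1})² = ζ_m`).

WHAT (all `m`; `Ω = PadicAlgCl 2`, `ζ_m = zeta 2 m`, statements written with the explicit expressions
`ζ_m + ζ_m⁻¹` = the memo's `u_{m−2}` and `ζ_m + ζ_m⁻¹ − 2` = the memo's `v_{m−2}`; no definitions):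
* §1 field identities: `(x + x⁻¹)² = x² + (x²)⁻¹ + 2`, `(x + x⁻¹)³ = x³ + (x³)⁻¹ + 3(x + x⁻¹)`,
  `x + x⁻¹ − 2 = x⁻¹(x − 1)²`, `x + x⁻¹ = y + y⁻¹ ↔ x = y ∨ x = y⁻¹`.
* §2 the tower: `(ζ_{m+1} + ζ_{m+1}⁻¹)² = 2 + (ζ_m + ζ_m⁻¹)`; hence **`v_{m+1}² + 4v_{m+1} = v_m`**; `u_0 = 2`, `u_1 = −2`
  (`v_1 = −4`, the memo's `v_{−1}`), `u_2 = 0` (`v_2 = −2`, the memo's `v_0`); **`‖v_m‖ = ‖ζ_m − 1‖²`**, so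
  `‖v_m‖^{2^{m−2}}` … precisely `‖v_m‖ ^ φ(2^m) = ‖2‖²` (`v_m` is a uniformizer of the plus field, of degree `2^{m−2}`).
* §3 Galois: an automorphism with `σ ζ_m = ζ_m^a` has `σ(u_m) = ζ_m^a + (ζ_m^a)⁻¹`; **`σ₃`** (`a = 3`, exists by
  `exists_algEquiv_apply_zeta_eq_pow`): `σ₃(u_m) = u_m³ − 3u_m`, i.e. **`σ₃(v_{m+1}) = (1 + v_m)·v_{m+1} + 2v_m`**;
  **`τ`** (`σ ζ_{m+1} = ζ_{m+1}^{2^m − 1} = −ζ_{m+1}⁻¹`, `m ≥ 1`): `τ(u_{m+1}) = −u_{m+1}`, i.e. **`τ(v_{m+1}) = −4 − v_{m+1}`**, while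
  `τ(u_m) = u_m`; and the stabiliser criterion `σ(u_m) = u_m ↔ σ ζ_m = ζ_m ∨ σ ζ_m = ζ_m⁻¹`.
These are the relations used in memo §4: the trace `Tr_{k_n/k_{n−1}} v_n = −4` (from `τ`), the tower lemma's
`σ₃(v) ≡ v + v³ (mod 2)` and `c_1 = 1 + v_{n−1}` (from `σ₃`), and the valuation bookkeeping of «Prop 8.11⁺ at 2».

HONEST FRAMING: THEOREMS ONLY (no definition, no named fact, no `sorry`), route-independent; elementary identities about roots of
unity in `ℚ̄₂`; closes no item; BSD is not proved by any of this.

References: [Washington1997] L. C. Washington, *Introduction to Cyclotomic Fields*, §13.1 (`ℚ_n = ℚ(ζ_{2^{n+2}})⁺`), Prop. 2.16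
(`ℚ(ζ)⁺ = ℚ(ζ + ζ⁻¹)`); [SerreLocalFields1979] Ch. IV §4 (uniformizers of cyclotomic extensions of `ℚ_p`); [Kobayashi2003] §8.4.
-/

set_option autoImplicit false
-- the Theorems namespace of this sub repeats the summit name by design (D-0017 nested layout)
set_option linter.dupNamespace false

noncomputable section

open scoped Classical

namespace Summit.BirchSwinnertonDyer.BirchSwinnertonDyer.Theorems.SignedEC.PlusTower

open Summit.BirchSwinnertonDyer.Rank1Residual.Additive.PadicCyclotomicTower

/-! ## §1 Field identities for `x + x⁻¹` -/

section Field

variable {F : Type*} [Field F]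

/-- `(x + x⁻¹)² = x² + (x²)⁻¹ + 2`. [folklore] -/
theorem add_inv_sq {x : F} (hx : x ≠ 0) : (x + x⁻¹) ^ 2 = x ^ 2 + (x ^ 2)⁻¹ + 2 := by
  field_simp
  ring

/-- `(x + x⁻¹)³ = x³ + (x³)⁻¹ + 3(x + x⁻¹)`. [folklore] -/
theorem add_inv_cube {x : F} (hx : x ≠ 0) : (x + x⁻¹) ^ 3 = x ^ 3 + (x ^ 3)⁻¹ + 3 * (x + x⁻¹) := by
  field_simp
  ring

/-- `x + x⁻¹ − 2 = x⁻¹ (x − 1)²`. [folklore] -/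
theorem add_inv_sub_two {x : F} (hx : x ≠ 0) : x + x⁻¹ - 2 = x⁻¹ * (x - 1) ^ 2 := by
  field_simp
  ring

/-- `x + x⁻¹ = y + y⁻¹ ↔ x = y ∨ x = y⁻¹` (`x, y ≠ 0`). [folklore] -/
theorem add_inv_eq_add_inv_iff {x y : F} (hx : x ≠ 0) (hy : y ≠ 0) : x + x⁻¹ = y + y⁻¹ ↔ x = y ∨ x = y⁻¹ := by
  constructor
  · intro h
    have h2 : (x - y) * (x * y - 1) = 0 := by
      have := congrArg (fun t ↦ t * (x * y)) h
      field_simp at this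
      linear_combination this
    rcases mul_eq_zero.mp h2 with h3 | h3
    · exact Or.inl (sub_eq_zero.mp h3)
    · right
      have : x * y = 1 := sub_eq_zero.mp h3
      exact eq_inv_of_mul_eq_one_left this
  · rintro (rfl | rfl)
    · rfl
    · rw [inv_inv, add_comm]

/-- `(x^a)⁻¹ = (x⁻¹)^a`, restated for rewriting automorphism images. [folklore] -/
theorem inv_pow_eq {x : F} (a : ℕ) : (x ^ a)⁻¹ = x⁻¹ ^ a := (inv_pow x a).symm

end Field

/-! ## §2 The tower `u_m = ζ_{2^m} + ζ_{2^m}⁻¹`, `v_m = u_m − 2` -/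

/-- `ζ_m ≠ 0`. [folklore] -/
theorem zeta_ne_zero (m : ℕ) : zeta 2 m ≠ 0 :=
  (isPrimitiveRoot_zeta 2 m).ne_zero (pow_ne_zero m two_ne_zero)

/-- **`u_{m+1}² = 2 + u_m`**: `(ζ_{m+1} + ζ_{m+1}⁻¹)² = 2 + (ζ_m + ζ_m⁻¹)` (from `ζ_{m+1}² = ζ_m`). [cite: Washington1997, §13.1] -/
theorem u_succ_sq (m : ℕ) :
    (zeta 2 (m + 1) + (zeta 2 (m + 1))⁻¹) ^ 2 = 2 + (zeta 2 m + (zeta 2 m)⁻¹) := by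
  rw [add_inv_sq (zeta_ne_zero (m + 1)), zeta_succ_pow]
  ring

/-- **`v_{m+1}² + 4 v_{m+1} = v_m`** for `v_m = ζ_m + ζ_m⁻¹ − 2`. [cite: Washington1997, §13.1] -/
theorem v_succ_sq_add (m : ℕ) :
    (zeta 2 (m + 1) + (zeta 2 (m + 1))⁻¹ - 2) ^ 2 + 4 * (zeta 2 (m + 1) + (zeta 2 (m + 1))⁻¹ - 2) =
      zeta 2 m + (zeta 2 m)⁻¹ - 2 := by
  have h := u_succ_sq m
  linear_combination h

/-- `v_{m+1}² = v_m − 4 v_{m+1}`, the form used to reduce `v_{m+1}`-powers modulo the lower layer. [folklore] -/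
theorem v_succ_sq (m : ℕ) :
    (zeta 2 (m + 1) + (zeta 2 (m + 1))⁻¹ - 2) ^ 2 =
      (zeta 2 m + (zeta 2 m)⁻¹ - 2) - 4 * (zeta 2 (m + 1) + (zeta 2 (m + 1))⁻¹ - 2) := by
  have h := v_succ_sq_add m
  linear_combination h

/-- `u_0 = 2` (`ζ_0 = 1`). [folklore] -/
theorem u_zero : zeta 2 0 + (zeta 2 0)⁻¹ = 2 := by
  rw [zeta_zero, inv_one]; norm_num

/-- `ζ_1 = −1` (the primitive square root of unity). [folklore] -/
theorem zeta_one : zeta 2 1 = -1 := by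
  have h := isPrimitiveRoot_zeta 2 1
  rw [pow_one] at h
  exact h.eq_neg_one_of_two_right

/-- `u_1 = −2`, i.e. `v_1 = −4` (the memo's `v_{−1} = −4`). [folklore] -/
theorem u_one : zeta 2 1 + (zeta 2 1)⁻¹ = -2 := by
  rw [zeta_one]; norm_num

/-- `ζ_2² = −1`. [folklore] -/
theorem zeta_two_sq : zeta 2 2 ^ 2 = -1 := by
  have h := zeta_succ_pow 2 1
  rw [zeta_one] at h
  exact h

/-- `u_2 = 0`, i.e. `v_2 = −2` (the memo's `v_0 = −2`): `ζ_4 + ζ_4⁻¹ = 0`. [folklore] -/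
theorem u_two : zeta 2 2 + (zeta 2 2)⁻¹ = 0 := by
  have h2 : zeta 2 2 * zeta 2 2 = -1 := by rw [← pow_two, zeta_two_sq]
  have h1 : zeta 2 2 * (-zeta 2 2) = 1 := by rw [mul_neg, h2, neg_neg]
  rw [inv_eq_of_mul_eq_one_right h1, add_neg_cancel]

/-- **`v_m = ζ_m⁻¹ (ζ_m − 1)²`.** [cite: SerreLocalFields1979, Ch. IV §4] -/
theorem v_eq (m : ℕ) : zeta 2 m + (zeta 2 m)⁻¹ - 2 = (zeta 2 m)⁻¹ * (zeta 2 m - 1) ^ 2 :=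
  add_inv_sub_two (zeta_ne_zero m)

/-- **`‖v_m‖ = ‖ζ_m − 1‖²`.** [cite: SerreLocalFields1979, Ch. IV §4] -/
theorem norm_v (m : ℕ) : ‖zeta 2 m + (zeta 2 m)⁻¹ - 2‖ = ‖zeta 2 m - 1‖ ^ 2 := by
  rw [v_eq, norm_mul, norm_inv, norm_zeta, inv_one, one_mul, norm_pow]

/-- **`‖v_m‖^{φ(2^m)} = ‖2‖²`** (`m ≥ 1`; `φ(2^m) = 2^{m−1} = 2·[ℚ₂(v_m):ℚ₂]`): `v_m` has the absolute value of a uniformizer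
of the degree-`2^{m−2}` totally ramified plus field. [cite: SerreLocalFields1979, Ch. IV §4] -/
theorem norm_v_pow {m : ℕ} (hm : 1 ≤ m) :
    ‖zeta 2 m + (zeta 2 m)⁻¹ - 2‖ ^ (2 ^ m).totient = ‖(2 : PadicAlgCl 2)‖ ^ 2 := by
  rw [norm_v, ← pow_mul, mul_comm, pow_mul, norm_zeta_sub_one_pow 2 hm]
  norm_cast

/-! ## §3 Galois action on the plus tower -/

section Galois

/-- An automorphism with `σ ζ_m = ζ_m^a` maps `u_m` to `ζ_m^a + (ζ_m^a)⁻¹`. [folklore] -/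
theorem apply_u_of_apply_zeta {m a : ℕ} {σ : PadicAlgCl 2 ≃ₐ[ℚ_[2]] PadicAlgCl 2} (h : σ (zeta 2 m) = zeta 2 m ^ a) :
    σ (zeta 2 m + (zeta 2 m)⁻¹) = zeta 2 m ^ a + (zeta 2 m ^ a)⁻¹ := by
  rw [map_add, map_inv₀, h]

/-- An automorphism acting as `ζ_{m+1} ↦ ζ_{m+1}^a` acts as `ζ_m ↦ ζ_m^a` on the layer below. [folklore] -/
theorem apply_zeta_of_apply_zeta_succ {m a : ℕ} {σ : PadicAlgCl 2 ≃ₐ[ℚ_[2]] PadicAlgCl 2}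
    (h : σ (zeta 2 (m + 1)) = zeta 2 (m + 1) ^ a) : σ (zeta 2 m) = zeta 2 m ^ a := by
  rw [← zeta_succ_pow 2 m, map_pow, h, ← pow_mul, mul_comm, pow_mul]

/-- **`σ₃` exists**: an automorphism of `ℚ̄₂/ℚ₂` with `σ ζ_m = ζ_m³` (`m ≥ 1`). [cite: Washington1997, §13.1] -/
theorem exists_sigma_three {m : ℕ} (hm : 1 ≤ m) :
    ∃ σ : PadicAlgCl 2 ≃ₐ[ℚ_[2]] PadicAlgCl 2, σ (zeta 2 m) = zeta 2 m ^ 3 :=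
  exists_algEquiv_apply_zeta_eq_pow 2 hm (by norm_num : Nat.Coprime 3 2)

/-- **`σ₃(u_m) = u_m³ − 3u_m`** for `σ ζ_m = ζ_m³`. [folklore] -/
theorem sigma_three_u {m : ℕ} {σ : PadicAlgCl 2 ≃ₐ[ℚ_[2]] PadicAlgCl 2} (h : σ (zeta 2 m) = zeta 2 m ^ 3) :
    σ (zeta 2 m + (zeta 2 m)⁻¹) = (zeta 2 m + (zeta 2 m)⁻¹) ^ 3 - 3 * (zeta 2 m + (zeta 2 m)⁻¹) := by
  rw [apply_u_of_apply_zeta h, add_inv_cube (zeta_ne_zero m)]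
  ring

/-- **`σ₃(v_{m+1}) = (1 + v_m)·v_{m+1} + 2 v_m`** for `σ ζ_{m+1} = ζ_{m+1}³` (the coefficient `c_1 = 1 + v_m` of the tower
lemma; uses `v_{m+1}² = v_m − 4v_{m+1}`). [cite: Washington1997, §13.1] -/
theorem sigma_three_v_succ {m : ℕ} {σ : PadicAlgCl 2 ≃ₐ[ℚ_[2]] PadicAlgCl 2} (h : σ (zeta 2 (m + 1)) = zeta 2 (m + 1) ^ 3) :
    σ (zeta 2 (m + 1) + (zeta 2 (m + 1))⁻¹ - 2) =
      (1 + (zeta 2 m + (zeta 2 m)⁻¹ - 2)) * (zeta 2 (m + 1) + (zeta 2 (m + 1))⁻¹ - 2) +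
        2 * (zeta 2 m + (zeta 2 m)⁻¹ - 2) := by
  have hsq := v_succ_sq m
  set v := zeta 2 (m + 1) + (zeta 2 (m + 1))⁻¹ - 2 with hv
  set v' := zeta 2 m + (zeta 2 m)⁻¹ - 2 with hv'
  have hu : σ (zeta 2 (m + 1) + (zeta 2 (m + 1))⁻¹) = (v + 2) ^ 3 - 3 * (v + 2) := by
    rw [sigma_three_u h, hv]; ring
  rw [map_sub, map_ofNat, hu]
  -- `(v+2)³ − 3(v+2) − 2 = v³ + 6v² + 9v`, and `v² = v' − 4v`, `v³ = v v' − 4v' + 16 v`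
  have hcube : v ^ 3 = v * v' - 4 * v' + 16 * v := by
    calc v ^ 3 = v * v ^ 2 := by ring
      _ = v * (v' - 4 * v) := by rw [hsq]
      _ = v * v' - 4 * v ^ 2 := by ring
      _ = v * v' - 4 * (v' - 4 * v) := by rw [hsq]
      _ = v * v' - 4 * v' + 16 * v := by ring
  linear_combination hcube + 6 * hsq

/-- **`τ` exists** (`m ≥ 1`): an automorphism with `σ ζ_{m+1} = ζ_{m+1}^{2^m + 2^{m+1} − 1}`, i.e. `σ ζ_{m+1} = −ζ_{m+1}⁻¹`
written with a natural exponent. [cite: Washington1997, §13.1] -/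
theorem exists_tau {m : ℕ} (hm : 1 ≤ m) :
    ∃ σ : PadicAlgCl 2 ≃ₐ[ℚ_[2]] PadicAlgCl 2, σ (zeta 2 (m + 1)) = zeta 2 (m + 1) ^ (2 ^ m + (2 ^ (m + 1) - 1)) := by
  refine exists_algEquiv_apply_zeta_eq_pow 2 (by omega) ?_
  rw [Nat.coprime_two_right]
  obtain ⟨m', rfl⟩ := Nat.exists_eq_add_of_le' hm
  have hb : 1 ≤ 2 ^ m' := Nat.one_le_two_pow
  have : 2 ^ (m' + 1) + (2 ^ (m' + 1 + 1) - 1) = 2 * (3 * 2 ^ m' - 1) + 1 := by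
    rw [pow_succ, pow_succ, pow_succ]; omega
  rw [this]; exact odd_two_mul_add_one _

/-- For `m ≥ 1`: `ζ_{m+1}^{2^m} = −1`. [folklore] -/
theorem zeta_succ_pow_two_pow {m : ℕ} (hm : 1 ≤ m) : zeta 2 (m + 1) ^ 2 ^ m = -1 := by
  obtain ⟨m', rfl⟩ := Nat.exists_eq_add_of_le' hm
  -- `ζ_{m'+2}^{2^{m'+1}} = ζ_1 = −1`
  have := zeta_add_pow 2 1 (m' + 1)
  rw [show 1 + (m' + 1) = m' + 1 + 1 by ring] at this
  rw [this, zeta_one]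

/-- **`τ(u_{m+1}) = −u_{m+1}`**, i.e. `τ(v_{m+1}) = −4 − v_{m+1}` (`m ≥ 1`), for `τ ζ_{m+1} = ζ_{m+1}^{2^m}·ζ_{m+1}^{2^{m+1}−1}
= −ζ_{m+1}⁻¹`; hence `Tr_{k/k'} v = −4` over the layer below. [cite: Washington1997, §13.1] -/
theorem tau_u_succ {m : ℕ} (hm : 1 ≤ m) {σ : PadicAlgCl 2 ≃ₐ[ℚ_[2]] PadicAlgCl 2}
    (h : σ (zeta 2 (m + 1)) = zeta 2 (m + 1) ^ (2 ^ m + (2 ^ (m + 1) - 1))) :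
    σ (zeta 2 (m + 1) + (zeta 2 (m + 1))⁻¹) = -(zeta 2 (m + 1) + (zeta 2 (m + 1))⁻¹) := by
  have h0 := zeta_ne_zero (m + 1)
  have hN : zeta 2 (m + 1) ^ 2 ^ (m + 1) = 1 := (isPrimitiveRoot_zeta 2 (m + 1)).pow_eq_one
  -- `ζ^{2^{m+1} − 1} = ζ⁻¹`
  have hinv : zeta 2 (m + 1) ^ (2 ^ (m + 1) - 1) = (zeta 2 (m + 1))⁻¹ :=
    eq_inv_of_mul_eq_one_left (by rw [← pow_succ, Nat.sub_add_cancel Nat.one_le_two_pow, hN])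
  have hσ : σ (zeta 2 (m + 1)) = -(zeta 2 (m + 1))⁻¹ := by
    rw [h, pow_add, zeta_succ_pow_two_pow hm, hinv, neg_one_mul]
  rw [map_add, map_inv₀, hσ, inv_neg, inv_inv]
  ring

/-- `τ(v_{m+1}) = −4 − v_{m+1}` (`m ≥ 1`). [cite: Washington1997, §13.1] -/
theorem tau_v_succ {m : ℕ} (hm : 1 ≤ m) {σ : PadicAlgCl 2 ≃ₐ[ℚ_[2]] PadicAlgCl 2}
    (h : σ (zeta 2 (m + 1)) = zeta 2 (m + 1) ^ (2 ^ m + (2 ^ (m + 1) - 1))) :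
    σ (zeta 2 (m + 1) + (zeta 2 (m + 1))⁻¹ - 2) = -4 - (zeta 2 (m + 1) + (zeta 2 (m + 1))⁻¹ - 2) := by
  rw [map_sub, map_ofNat, tau_u_succ hm h]; ring

/-- `τ` fixes the layer below: `τ(u_m) = u_m` (`τ ζ_m = (τ ζ_{m+1})² = ζ_m⁻¹`). [cite: Washington1997, §13.1] -/
theorem tau_u {m : ℕ} {σ : PadicAlgCl 2 ≃ₐ[ℚ_[2]] PadicAlgCl 2}
    (h : σ (zeta 2 (m + 1)) = zeta 2 (m + 1) ^ (2 ^ m + (2 ^ (m + 1) - 1))) :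
    σ (zeta 2 m + (zeta 2 m)⁻¹) = zeta 2 m + (zeta 2 m)⁻¹ := by
  have hz : σ (zeta 2 m) = (zeta 2 m)⁻¹ := by
    have h2 := apply_zeta_of_apply_zeta_succ h
    have hN : zeta 2 m ^ 2 ^ m = 1 := (isPrimitiveRoot_zeta 2 m).pow_eq_one
    rw [h2]
    refine eq_inv_of_mul_eq_one_left ?_
    rw [← pow_succ]
    have : 2 ^ m + (2 ^ (m + 1) - 1) + 1 = 2 ^ m * 3 := by
      have h1 : 1 ≤ 2 ^ (m + 1) := Nat.one_le_two_pow
      rw [pow_succ] at h1 ⊢; omega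
    rw [this, pow_mul, hN, one_pow]
  rw [map_add, map_inv₀, hz, inv_inv, add_comm]

/-- **Stabiliser criterion**: `σ(u_m) = u_m ↔ σ ζ_m = ζ_m ∨ σ ζ_m = ζ_m⁻¹` — the plus field `ℚ₂(u_m)` is the fixed field of
`{±1} ⊂ (ℤ/2^m)ˣ`. [cite: Washington1997, Prop. 2.16 and §13.1] -/
theorem apply_u_eq_iff {m : ℕ} (σ : PadicAlgCl 2 ≃ₐ[ℚ_[2]] PadicAlgCl 2) :
    σ (zeta 2 m + (zeta 2 m)⁻¹) = zeta 2 m + (zeta 2 m)⁻¹ ↔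
      σ (zeta 2 m) = zeta 2 m ∨ σ (zeta 2 m) = (zeta 2 m)⁻¹ := by
  rw [map_add, map_inv₀]
  exact add_inv_eq_add_inv_iff ((map_ne_zero σ).mpr (zeta_ne_zero m)) (zeta_ne_zero m)

end Galois

end Summit.BirchSwinnertonDyer.BirchSwinnertonDyer.Theorems.SignedEC.PlusTower

end
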